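/-
Copyright (c) 2026. All rights reserved.
Released under Apache 2.0 license as described in the file LICENSE.
Authors: abc-iut cell, fact-proving seat abc-iut-f-102 (block F, tranche 102).
-/
import Literature.AnabelianGeometry.AbsoluteAnabelian.DiagramMorphisms

/-!
# The isomorphisms `Φ_{[γ]}` of a 1-morphism of diagrams of categories along paths ([AbsTopIII] Def. 3.5 (v), toolkit)

S. Mochizuki, *Topics in Absolute Anabelian Geometry III*, Def. 3.5 (v) p. 76 (manuscript `paper:url-5493eb38cbb7`,
bib key `MochizukiAbsTopIII2015`): a 1-morphism `Φ : 𝒟 → 𝒟'` of diagrams of categories consists of functors `Φ_v` and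
isomorphisms `Φ_e : 𝒟'_{Φe} ∘ Φ_{v₁} ⥲ Φ_{v₂} ∘ 𝒟_e`; its compatibility with families of homotopies ("the natural
transformations that constitute `ℋ`, `ℋ'` are compatible with the natural transformations that constitute `Φ`") is typed
in `DiagramMorphisms.lean` (abc-iut-L4-t2, `OneMorphism.CompatibleWith`) through the composite isomorphisms
`Φ_{[γ]} : Φ_{v₁} ⋙ 𝒟'_{[Φγ]} ≅ 𝒟_{[γ]} ⋙ Φ_{v₂}` along paths, recorded there as a DATUM `pathIso` pinned by its values on
the empty path and on `[γ]·e`.  This file CONSTRUCTS that datum once and for all (`OneMorphism.pathIso`, by the pinned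
recursion, so that `pathIso_nil` / `pathIso_cons` of `CompatibleWith` hold by `rfl` / unfolding) and proves the one
property every "strictly commuting" 1-morphism (all `Φ_e` are `eqToIso`s — e.g. the shifts `⋎ ↦ ⋎ + k` of `D•⊢`,
[AbsTopIII] Cor 5.5 (v)) needs: every component of every `Φ_{[γ]}` is an `eqToHom` (`pathIso_hom_app_eq_eqToHom`).
First consumer: `LogFrobeniusShiftActionDiagonal.lean` (this seat).  Pure category theory (whiskering and `eqToHom`
bookkeeping); no claim of the paper is asserted.
-/

set_option autoImplicit false

namespace Literature.AnabelianGeometry.AbsoluteAnabelian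

open _root_.CategoryTheory _root_.Quiver

universe v u w

/-! ### Bookkeeping: morphisms that are `eqToHom`s -/

section EqToHomLike

variable {C : Type*} [Category C] {C' : Type*} [Category C']

/-- an identity is an `eqToHom`. [folklore] -/
private theorem exists_eqToHom_id (X : C) : ∃ h : X = X, 𝟙 X = eqToHom h := ⟨rfl, rfl⟩

/-- a composite of two `eqToHom`s is an `eqToHom`. [folklore] -/
private theorem exists_eqToHom_comp {X Y Z : C} {f : X ⟶ Y} {g : Y ⟶ Z} (hf : ∃ h, f = eqToHom h)
    (hg : ∃ h, g = eqToHom h) : ∃ h, f ≫ g = eqToHom h := by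
  obtain ⟨p, rfl⟩ := hf
  obtain ⟨q, rfl⟩ := hg
  exact ⟨p.trans q, eqToHom_trans p q⟩

/-- a functor maps an `eqToHom` to an `eqToHom`. [folklore] -/
private theorem exists_eqToHom_map (G : C ⥤ C') {X Y : C} {f : X ⟶ Y} (hf : ∃ h, f = eqToHom h) :
    ∃ h, G.map f = eqToHom h := by
  obtain ⟨p, rfl⟩ := hf
  exact ⟨congrArg G.obj p, eqToHom_map G p⟩

/-- a component of an `eqToIso` between functors is an `eqToHom`. [folklore] -/
private theorem exists_eqToHom_isoApp {A : Type*} [Category A] {F G : A ⥤ C} {i : F ≅ G} (hi : ∃ H, i = eqToIso H)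
    (X : A) : ∃ h, i.hom.app X = eqToHom h := by
  obtain ⟨p, rfl⟩ := hi
  exact ⟨Functor.congr_obj p X, by rw [eqToIso.hom, eqToHom_app]⟩

end EqToHomLike

/-! ### Definition 3.5 (v): `Φ_{[γ]}` -/

namespace DiagramOfCategories

namespace OneMorphism

variable {V : Type w} [Quiver.{v} V] {V' : Type w} [Quiver.{v} V'] {F : V ⥤q V'}
  {D : DiagramOfCategories.{v, u, w} V} {D' : DiagramOfCategories.{v, u, w} V'}

/-- **The isomorphisms `Φ_{[γ]} : Φ_{v₁} ⋙ 𝒟'_{[Φ_Γ⃗ γ]} ≅ 𝒟_{[γ]} ⋙ Φ_{v₂}` of a 1-morphism `Φ : 𝒟 → 𝒟'` along a path `[γ]`**,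
composed from the 2-cells `Φ_e` (Def 3.5 (v): "the natural transformations that constitute `Φ`"), by the recursion that
`OneMorphism.CompatibleWith` pins (`pathIso_nil`, `pathIso_cons` there: unitors on the empty path; `Φ_{[γ]}` whiskered
with `𝒟'_{Φe}`, then `Φ_e` whiskered with `𝒟_{[γ]}`, on `[γ]·e`). [cite: MochizukiAbsTopIII2015, Definition 3.5 (v) p.76] -/
noncomputable def pathIso (Φ : OneMorphism F D D') {a : V} :
    ∀ {b : V} (p : Path a b), Φ.app a ⋙ D'.pathFunctor (F.mapPath p) ≅ D.pathFunctor p ⋙ Φ.app b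
  | _, .nil =>
    eqToIso (by rw [Prefunctor.mapPath_nil, pathFunctor_nil]) ≪≫
      ((Φ.app a).rightUnitor ≪≫ (Φ.app a).leftUnitor.symm) ≪≫ eqToIso (by rw [pathFunctor_nil])
  | _, .cons p e =>
    eqToIso (by rw [Prefunctor.mapPath_cons, pathFunctor_cons]) ≪≫
      ((Functor.associator _ _ _).symm ≪≫ Functor.isoWhiskerRight (pathIso Φ p) (D'.map (F.map e)) ≪≫
        Functor.associator _ _ _ ≪≫ Functor.isoWhiskerLeft (D.pathFunctor p) (Φ.iso e) ≪≫
        (Functor.associator _ _ _).symm) ≪≫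
      eqToIso (by rw [pathFunctor_cons])

/-- `Φ_{[]}` on the empty path: the unitors (between the `eqToIso`s of `𝒟'_{[]} = id`, `𝒟_{[]} = id`), literally as
`OneMorphism.CompatibleWith.pathIso_nil` requires. [cite: MochizukiAbsTopIII2015, Definition 3.5 (v) p.76] -/
theorem pathIso_nil (Φ : OneMorphism F D D') (a : V) : Φ.pathIso (Path.nil : Path a a) =
    eqToIso (by rw [Prefunctor.mapPath_nil, pathFunctor_nil]) ≪≫
      ((Φ.app a).rightUnitor ≪≫ (Φ.app a).leftUnitor.symm) ≪≫ eqToIso (by rw [pathFunctor_nil]) := rfl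

/-- `Φ_{[γ·e]}` from `Φ_{[γ]}` and `Φ_e`, literally as `OneMorphism.CompatibleWith.pathIso_cons` requires.
[cite: MochizukiAbsTopIII2015, Definition 3.5 (v) p.76] -/
theorem pathIso_cons (Φ : OneMorphism F D D') {a b c : V} (p : Path a b) (e : b ⟶ c) : Φ.pathIso (p.cons e) =
    eqToIso (by rw [Prefunctor.mapPath_cons, pathFunctor_cons]) ≪≫
      ((Functor.associator _ _ _).symm ≪≫ Functor.isoWhiskerRight (Φ.pathIso p) (D'.map (F.map e)) ≪≫
        Functor.associator _ _ _ ≪≫ Functor.isoWhiskerLeft (D.pathFunctor p) (Φ.iso e) ≪≫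
        (Functor.associator _ _ _).symm) ≪≫
      eqToIso (by rw [pathFunctor_cons]) := by
  rw [pathIso]

/-- **Strictly commuting 1-morphisms have `eqToHom` path isomorphisms**: if every 2-cell `Φ_e` of `Φ` is an `eqToIso`, then
every component of every `Φ_{[γ]}` is an `eqToHom` (induction along `[γ]`: unitors and associators have identity
components, functors map `eqToHom`s to `eqToHom`s). [cite: MochizukiAbsTopIII2015, Definition 3.5 (v) p.76] -/
theorem pathIso_hom_app_eq_eqToHom (Φ : OneMorphism F D D') (hΦ : ∀ {a b : V} (e : a ⟶ b), ∃ H, Φ.iso e = eqToIso H)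
    {a : V} : ∀ {b : V} (p : Path a b) (x : D.obj a), ∃ h, (Φ.pathIso p).hom.app x = eqToHom h
  | _, .nil, x => by
    rw [pathIso]
    simp only [Iso.trans_hom, NatTrans.comp_app]
    exact exists_eqToHom_comp (exists_eqToHom_isoApp ⟨_, rfl⟩ x)
      (exists_eqToHom_comp (exists_eqToHom_comp (exists_eqToHom_id _) (exists_eqToHom_id _))
        (exists_eqToHom_isoApp ⟨_, rfl⟩ x))
  | _, .cons p e, x => by
    rw [pathIso]
    simp only [Iso.trans_hom, NatTrans.comp_app]
    exact exists_eqToHom_comp (exists_eqToHom_isoApp ⟨_, rfl⟩ x)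
      (exists_eqToHom_comp
        (exists_eqToHom_comp (exists_eqToHom_id _)
          (exists_eqToHom_comp (exists_eqToHom_map _ (pathIso_hom_app_eq_eqToHom Φ hΦ p x))
            (exists_eqToHom_comp (exists_eqToHom_id _)
              (exists_eqToHom_comp (exists_eqToHom_isoApp (hΦ e) _) (exists_eqToHom_id _)))))
        (exists_eqToHom_isoApp ⟨_, rfl⟩ x))

/-- … hence, for two co-verticial paths, the components of `Φ_{[γ₁]}` and `Φ_{[γ₂]}` at one object are `eqToHom`s between the
same pairs of objects up to the equalities they witness — the form in which `η_compat` of `OneMorphism.CompatibleWith` is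
checked for families of homotopies whose homotopies are themselves `eqToHom`s. [cite: MochizukiAbsTopIII2015, Definition 3.5 (v) p.76] -/
theorem exists_pathIso_hom_app_eq (Φ : OneMorphism F D D') (hΦ : ∀ {a b : V} (e : a ⟶ b), ∃ H, Φ.iso e = eqToIso H)
    {a b : V} (p q : Path a b) (x : D.obj a) :
    ∃ (h₁ : (Φ.app a ⋙ D'.pathFunctor (F.mapPath p)).obj x = (D.pathFunctor p ⋙ Φ.app b).obj x)
      (h₂ : (Φ.app a ⋙ D'.pathFunctor (F.mapPath q)).obj x = (D.pathFunctor q ⋙ Φ.app b).obj x),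
      (Φ.pathIso p).hom.app x = eqToHom h₁ ∧ (Φ.pathIso q).hom.app x = eqToHom h₂ := by
  obtain ⟨h₁, e₁⟩ := Φ.pathIso_hom_app_eq_eqToHom hΦ p x
  obtain ⟨h₂, e₂⟩ := Φ.pathIso_hom_app_eq_eqToHom hΦ q x
  exact ⟨h₁, h₂, e₁, e₂⟩

/-- **The datum `pathIso` of a compatibility witness IS `Φ_{[γ]}`**: `OneMorphism.CompatibleWith` pins its `pathIso` by
`pathIso_nil` / `pathIso_cons`, i.e. by the defining recursion of `OneMorphism.pathIso` — so any two compatibility witnesses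
of one `Φ` have the same path isomorphisms, and results about `Φ.pathIso` (e.g. `pathIso_hom_app_eq_eqToHom`) apply to
the datum. [cite: MochizukiAbsTopIII2015, Definition 3.5 (v) p.76] -/
theorem CompatibleWith.pathIso_eq_pathIso {Φ : OneMorphism F D D'} {H : D.HomotopyFamily} {H' : D'.HomotopyFamily}
    (Ψ : Φ.CompatibleWith H H') {a : V} : ∀ {b : V} (p : Path a b), Ψ.pathIso p = Φ.pathIso p
  | _, .nil => (Ψ.pathIso_nil _).trans (OneMorphism.pathIso_nil Φ _).symm
  | _, .cons p e => by
    rw [Ψ.pathIso_cons, OneMorphism.pathIso_cons, CompatibleWith.pathIso_eq_pathIso Ψ p]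

end OneMorphism

end DiagramOfCategories

end Literature.AnabelianGeometry.AbsoluteAnabelian
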